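/-
Copyright: seat `ym-line-cbag-p2` (prover-ym-line-cbag-p2-g0-0), route `ColdBoxAllGroups`, crux `BulkAllGroups`
(stmt-QuantumFields-22255), line `dlr-chessboard-G` (skeleton `Cruxes/BulkAllGroups/Lines/birth.lean`).
-/
import Summits.QuantumFields.YangMills.Theorems.ColdBoxAllGroupsDefs
import Summits.QuantumFields.YangMills.Theorems.WeakCouplingRatesLargeFieldTailAllSides
import Literature.MathematicalPhysics.QuantumFieldTheory.WilsonPlaquetteChessboardTail
import Literature.MathematicalPhysics.QuantumFieldTheory.BalabanBlockSpecification
import Literature.RepresentationTheory.CompactGroups.UnitaryTrick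
import Summits.QuantumFields.YangMills.Theorems.BalabanLadderIROddTorusLargeFieldRarityRep

/-!
# The single-plaquette large-field tail of the Wilson torus states of ANY compact gauge group, uniformly in the volume —
# part 1 of stub L2-G `stub_largeFieldRarityG` of the `dlr-chessboard-G` line (crux `BulkAllGroups`, stmt-QuantumFields-22255)

WHAT.  For the Wilson measure of a compact group `G` with a faithful continuous unitary representation `r : LatticeRep G`
(`wilsonMeasure r.ρ β`, weight `exp(−β Σ_p (N − Re tr ρ U_p))`) on the torus `(ℤ/Lℤ)⁴`, `β ≥ 1`:

* `measureReal_plaqCost_ge_le_evenG` — the Peierls–chessboard tail `μ{U : s ≤ N − Re tr ρ U_p} ≤ C·β^{2D}·exp(−β s/2)` for every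
  plaquette, every `s ≥ 0`, every EVEN `L ≥ 2`, ONE constant `C` (`D = dimE r.ρ`): the host tree's G-generic
  `WilsonPlaquetteTail.measureReal_plaquette_mem_le` (reflection positivity + the Fröhlich–Israel–Lieb–Simon chessboard estimate) with
  the event `E = {s ≤ N − Re tr ρ}` (a class function, inversion invariant: `CompactGroup.trace_conj_eq`, `re_trace_map_inv`), the
  Hilbert–Schmidt link ball `B = {‖ρ g − 1‖ ≤ β^{−1/2}}` (four-link energies `≤ 8β^{−1}`: `DoublingOfRV.sub_re_trace_le`,
  `norm_rho_mul_sub_one_le`) of Haar mass `≥ C₁ β^{−D/2}` (`exists_haar_gball_ge`, the landed exponential-chart package);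
* `measureReal_plaqCost_ge_le_oddG` — the same shape `C β^κ exp(−β s/2)` for every ODD `L ≥ 3`: Chebyshev with `e^{(β/2)φ_p}`, the tree's
  odd-torus reflection-positivity doubling `SoloBlind.wilsonExpectation_exp_plaquetteCost_le`, and the crude partition-function bounds
  of the tree (`OddTorusChessboard.torusLogPartition_nonpos_rep`, `…_lower_rep`: `log Z_L(β/2) ≤ 0`,
  `log Z_L(β) ≥ −48L⁴ + 4L⁴(log C₁ − (D/2) log β)`), so that the exponent is volume-free;
* `measureReal_plaqCost_ge_le_allSidesG` — both parities, ALL `L ≥ 2`.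

Part 2 (`ColdBoxAllGroupsBulkAllGroupsStubLargeFieldRarityG`) turns this into the line's predicate `PlaquetteLargeFieldRarityG r.ρ δ`
for every `δ > 0` and lands the registered stub by name.  G-port of `WeakCouplingRatesLargeFieldTail{,AllSides}` (SU(2), p445862).

WHAT THIS IS NOT.  Not a statement about the mass gap; a large-field RARITY bound (probability of ONE plaquette deviation above the
Gaussian scale), uniform in the volume, nothing about decoupling.  The Yang–Mills mass gap is NOT proved by any of this.

References: [FrohlichIsraelLiebSimon1978] Thm. 4.1 (chessboard estimate); E. Seiler, LNP 159 (1982) Ch. 4; K. Osterwalder, E. Seiler,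
Ann. Phys. 110 (1978) §2 (site reflections); S. Chatterjee, arXiv:1602.01222 Cor. 6.3 (Haar small balls).
-/

set_option autoImplicit false

noncomputable section

open scoped Matrix.Norms.Frobenius
open MeasureTheory Filter Topology
open Literature.MathematicalPhysics
open Literature.MathematicalPhysics.QuantumFieldTheory
open Literature.MathematicalPhysics.QuantumLattice
open Literature.Probability.LatticeModels (Torus.proj)
open Literature.RepresentationTheory.CompactGroups
open Summit.QuantumFields.YangMills.Theorems.WeakCouplingRates
open Summit.QuantumFields.YangMills.Theorems.FreeEnergyLogCoefficient (dimE exists_haar_gball_ge)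
open Summit.QuantumFields.YangMills.Theorems.FemtoCurvatureTwoPoint

namespace Summit.QuantumFields.YangMills.Theorems.ColdBoxAllGroups

variable {G : Type} [Group G] [TopologicalSpace G] [IsTopologicalGroup G] [CompactSpace G] [MeasurableSpace G] [BorelSpace G]

/-! ### The even-side single-plaquette tail (chessboard) -/

/-- **The single-plaquette energy tail of the Wilson torus, any compact `G`, uniformly in the EVEN volume**:
`μ_{L,β}{U : s ≤ N − Re tr ρ U_p} ≤ C β^{2D} exp(−β s/2)` for `β ≥ 1`, `s ≥ 0`, `L` even, every plaquette `p = (x; i, j)`, `D = dimE r.ρ`.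
[cite: FrohlichIsraelLiebSimon1978, Thm. 4.1] -/
theorem measureReal_plaqCost_ge_le_evenG (r : LatticeRep G) :
    ∃ C : ℝ, 0 < C ∧ ∀ {L : ℕ} [NeZero L] [Fact (1 < L)], Even L → ∀ (β : ℝ), 1 ≤ β → ∀ (s : ℝ), 0 ≤ s →
      ∀ (x : Site 4 L) {i j : Fin 4}, i ≠ j →
        (wilsonMeasure (d := 4) (L := L) r.ρ β).real
            {U : GaugeConfig 4 L G | s ≤ (r.N : ℝ) - (r.ρ (plaquetteHolonomy U x i j)).trace.re} ≤
          C * β ^ (2 * dimE r.ρ) * Real.exp (-(β * s / 2)) := by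
  haveI : SecondCountableTopology G := r.secondCountableTopology
  obtain ⟨c, hc, hball⟩ := exists_haar_gball_ge r.ρ r.continuous r.injective r.mem_unitary
  refine ⟨2 * Real.exp (8 * Fintype.card {q : Fin 4 × Fin 4 // q.1 < q.2}) * (c ^ 4)⁻¹, by positivity, ?_⟩
  intro L _ _ hL β hβ s hs x i j hij
  set ρ := r.ρ with hρdef
  set D : ℕ := dimE ρ with hD
  have hρc : Continuous ρ := r.continuous
  have hρu : ∀ g, ρ g ∈ Matrix.unitaryGroup (Fin r.N) ℂ := r.mem_unitary
  have hβ0 : 0 < β := lt_of_lt_of_le one_pos hβ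
  -- the radius `δ = β^{-1/2}` and the link ball (Hilbert–Schmidt norm)
  set δ : ℝ := (Real.sqrt β)⁻¹ with hδ
  have hsβ : 0 < Real.sqrt β := Real.sqrt_pos.2 hβ0
  have hδ0 : 0 < δ := inv_pos.2 hsβ
  have hδ1 : δ ≤ 1 := by rw [hδ]; exact inv_le_one_of_one_le₀ (Real.one_le_sqrt.2 hβ)
  have hδ2 : δ ^ 2 = β⁻¹ := by rw [hδ, inv_pow, Real.sq_sqrt hβ0.le]
  set B : Set G := {g | ‖ρ g - 1‖ ≤ δ} with hB
  have hcont1 : Continuous fun g : G => ‖ρ g - 1‖ := (hρc.sub continuous_const).norm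
  have hBm : MeasurableSet B := measurableSet_le hcont1.measurable measurable_const
  have hvol : c * δ ^ D ≤ (haarProbability G).real B := by
    rw [measureReal_def]
    exact (ENNReal.ofReal_le_iff_le_toReal (measure_ne_top _ _)).1 (hball δ hδ0 hδ1)
  have hcr : 0 < c * δ ^ D := mul_pos hc (pow_pos hδ0 _)
  have hBpos : 0 < (haarProbability G).real B := lt_of_lt_of_le hcr hvol
  -- four-link energies on the ball: `≤ (4δ)²/2 = 8 δ²`
  have hBen : ∀ g₁ g₂ g₃ g₄ : G, g₁ ∈ B → g₂ ∈ B → g₃ ∈ B → g₄ ∈ B →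
      ((r.N : ℕ) : ℝ) - (ρ (g₁ * g₂ * g₃⁻¹ * g₄⁻¹)).trace.re ≤ 8 * δ ^ 2 := by
    intro g₁ g₂ g₃ g₄ h₁ h₂ h₃ h₄
    simp only [hB, Set.mem_setOf_eq] at h₁ h₂ h₃ h₄
    have hd : ‖ρ (g₁ * g₂ * g₃⁻¹ * g₄⁻¹) - 1‖ ≤ 4 * δ := by
      calc ‖ρ (g₁ * g₂ * g₃⁻¹ * g₄⁻¹) - 1‖ ≤ ‖ρ (g₁ * g₂ * g₃⁻¹) - 1‖ + ‖ρ g₄⁻¹ - 1‖ :=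
            DoublingOfRV.norm_rho_mul_sub_one_le ρ hρu _ _
        _ ≤ ‖ρ (g₁ * g₂) - 1‖ + ‖ρ g₃⁻¹ - 1‖ + ‖ρ g₄⁻¹ - 1‖ := by
            have := DoublingOfRV.norm_rho_mul_sub_one_le ρ hρu (g₁ * g₂) g₃⁻¹; linarith
        _ ≤ ‖ρ g₁ - 1‖ + ‖ρ g₂ - 1‖ + ‖ρ g₃⁻¹ - 1‖ + ‖ρ g₄⁻¹ - 1‖ := by
            have := DoublingOfRV.norm_rho_mul_sub_one_le ρ hρu g₁ g₂; linarith
        _ = ‖ρ g₁ - 1‖ + ‖ρ g₂ - 1‖ + ‖ρ g₃ - 1‖ + ‖ρ g₄ - 1‖ := by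
            rw [DoublingOfRV.norm_rho_inv_sub_one ρ hρu, DoublingOfRV.norm_rho_inv_sub_one ρ hρu]
        _ ≤ 4 * δ := by linarith
    have h := DoublingOfRV.sub_re_trace_le ρ hρu (g₁ * g₂ * g₃⁻¹ * g₄⁻¹) hd
    have e : (4 * δ) ^ 2 / 2 = 8 * δ ^ 2 := by ring
    linarith
  -- the large-field event `s ≤ N − Re tr ρ`: a class function, inversion invariant
  set E : Set G := {g | s ≤ (r.N : ℝ) - (ρ g).trace.re} with hE
  have hcont2 : Continuous fun g : G => (r.N : ℝ) - (ρ g).trace.re :=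
    continuous_const.sub (Complex.continuous_re.comp hρc.matrix_trace)
  have hEm : MeasurableSet E := measurableSet_le measurable_const hcont2.measurable
  have hEconj : ∀ g h : G, h * g * h⁻¹ ∈ E ↔ g ∈ E := fun g h => by
    simp only [hE, Set.mem_setOf_eq, CompactGroup.trace_conj_eq ρ g h]
  have hEinv : ∀ g : G, g⁻¹ ∈ E ↔ g ∈ E := fun g => by
    simp only [hE, Set.mem_setOf_eq, CompactGroup.re_trace_map_inv ρ hρc g]
  have hEen : ∀ g ∈ E, s ≤ ((r.N : ℕ) : ℝ) - (ρ g).trace.re := fun g hg => by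
    simpa only [hE, Set.mem_setOf_eq] using hg
  have htr : ∀ g : G, (ρ g).trace.re ≤ ((r.N : ℕ) : ℝ) := fun g => by
    have h := CompactGroup.abs_re_trace_le_card ρ hρc g
    simp only [Fintype.card_fin] at h
    exact (abs_le.1 h).2
  haveI := isProbabilityMeasure_wilsonMeasure (d := 4) (L := L) ρ hρc β
  have hset : {U : GaugeConfig 4 L G | s ≤ (r.N : ℝ) - (ρ (plaquetteHolonomy U x i j)).trace.re} =
      {U : GaugeConfig 4 L G | plaquetteHolonomy U x i j ∈ E} := by
    ext U; simp only [Set.mem_setOf_eq, hE]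
  rw [hset]
  -- the host-tree bound at coupling `β`
  have hmain := WilsonPlaquetteTail.measureReal_plaquette_mem_le (d := 4) (L := L) ρ hL hρc htr hβ0.le
    hEm hEconj hEinv hEen hBm hBpos hBen x hij
  refine hmain.trans ?_
  -- arithmetic: `β (8 δ²) = 8`, `Haar(B)^4 ≥ (c δ^D)^4 = c^4 β^{-2D}`, `e^{-βs}(1 + e^{-βs}) ≤ 2 e^{-βs/2}`
  have e2 : β * (8 * δ ^ 2) = 8 := by rw [hδ2]; field_simp
  rw [e2]
  set X := Real.exp (-(β * s)) with hX
  have hX0 : 0 < X := Real.exp_pos _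
  have hX1 : X ≤ 1 := by
    rw [hX, Real.exp_le_one_iff]
    have : 0 ≤ β * s := by positivity
    linarith
  set Xh := Real.exp (-(β * s / 2)) with hXh
  have hXXh : X ≤ Xh := Real.exp_le_exp.2 (by
    have : 0 ≤ β * s := by positivity
    linarith)
  set P₂ : ℝ := (Fintype.card {q : Fin 4 × Fin 4 // q.1 < q.2} : ℝ) with hP₂
  set Y := Real.exp (8 * P₂) with hY
  have hY0 : 0 < Y := Real.exp_pos _
  have hvol_d : (c * δ ^ D) ^ 4 ≤ (haarProbability G).real B ^ 4 := pow_le_pow_left₀ hcr.le hvol _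
  have hinv : ((haarProbability G).real B ^ 4)⁻¹ ≤ ((c * δ ^ D) ^ 4)⁻¹ := inv_anti₀ (pow_pos hcr _) hvol_d
  have hrpow : ((c * δ ^ D) ^ 4)⁻¹ = (c ^ 4)⁻¹ * β ^ (2 * D) := by
    have hδD : (δ ^ D) ^ 4 = (β ^ (2 * D))⁻¹ := by
      rw [← pow_mul, show D * 4 = 2 * (2 * D) by ring, pow_mul, hδ2, inv_pow]
    rw [mul_pow, hδD, mul_inv, inv_inv]
  calc (1 + X) * X * Y / (haarProbability G).real B ^ 4
      = (1 + X) * X * Y * ((haarProbability G).real B ^ 4)⁻¹ := by rw [div_eq_mul_inv]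
    _ ≤ 2 * Xh * Y * ((c * δ ^ D) ^ 4)⁻¹ := by
        have h12 : (1 + X) * X * Y ≤ 2 * Xh * Y := by
          have : (1 + X) * X ≤ 2 * Xh := by nlinarith
          exact mul_le_mul_of_nonneg_right this hY0.le
        exact mul_le_mul h12 hinv (inv_nonneg.2 (pow_nonneg hBpos.le _)) (by positivity)
    _ = 2 * Y * (c ^ 4)⁻¹ * β ^ (2 * D) * Xh := by rw [hrpow]; ring

/-! ### The odd-side single-plaquette tail (reflection-positivity doubling) -/

/-- **The single-plaquette energy tail of the Wilson torus, any compact `G`, uniformly in the ODD volume**: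
`μ_{L,β}{U : s ≤ N − Re tr ρ U_p} ≤ C β^κ exp(−β s/2)` for `β ≥ 1`, `s ≥ 0`, `L ≥ 3` odd, every plaquette `p = (x; i, j)`, ONE
constant `C` and ONE power `κ` — Chebyshev with `e^{(β/2)φ_p}`, the odd-torus doubling `SoloBlind.wilsonExpectation_exp_plaquetteCost_le`,
and the crude partition-function bounds above. [cite: FrohlichIsraelLiebSimon1978, Thm. 4.1] -/
theorem measureReal_plaqCost_ge_le_oddG (r : LatticeRep G) :
    ∃ C : ℝ, 0 < C ∧ ∃ κ : ℕ, ∀ {L : ℕ} [NeZero L], Odd L → 3 ≤ L → ∀ (β : ℝ), 1 ≤ β → ∀ (s : ℝ), 0 ≤ s →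
      ∀ (x : Site 4 L) {i j : Fin 4}, i ≠ j →
        (wilsonMeasure (d := 4) (L := L) r.ρ β).real
            {U : GaugeConfig 4 L G | s ≤ (r.N : ℝ) - (r.ρ (plaquetteHolonomy U x i j)).trace.re} ≤
          C * β ^ κ * Real.exp (-(β * s / 2)) := by
  obtain ⟨C₁, hC₁, hZ⟩ := OddTorusChessboard.torusLogPartition_lower_rep r
  refine ⟨Real.exp (12288 - 1024 * Real.log C₁), Real.exp_pos _, 512 * dimE r.ρ, ?_⟩
  intro L _ hL hL3 β hβ s _ x i j hij
  set ρ := r.ρ with hρdef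
  set D : ℕ := dimE r.ρ with hD
  have hρc : Continuous ρ := r.continuous
  have hβ0 : 0 < β := lt_of_lt_of_le one_pos hβ
  haveI := isProbabilityMeasure_wilsonMeasure (d := 4) (L := L) ρ hρc β
  -- orient the plaquette: `i < j` or `j < i`, the cost is symmetric
  obtain ⟨p, hp⟩ : ∃ p : Plaquette 4 L, ∀ U : GaugeConfig 4 L G,
      SoloBlind.plaquetteCost ρ p.1 p.2.1.1 p.2.1.2 U = (r.N : ℝ) - (ρ (plaquetteHolonomy U x i j)).trace.re := by
    rcases lt_or_gt_of_ne hij with h | h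
    · exact ⟨(x, ⟨(i, j), h⟩), fun U => by simp [SoloBlind.plaquetteCost]⟩
    · refine ⟨(x, ⟨(j, i), h⟩), fun U => ?_⟩
      have hs := SoloBlind.plaquetteCost_symm ρ hρc x i j U
      simp only [SoloBlind.plaquetteCost] at hs ⊢
      exact hs
  -- Chebyshev with `c = β/2`
  have hφm : Measurable (SoloBlind.plaquetteCost (G := G) ρ p.1 p.2.1.1 p.2.1.2) :=
    SoloBlind.measurable_plaquetteCost ρ hρc p
  have hφK : ∀ U : GaugeConfig 4 L G, |SoloBlind.plaquetteCost ρ p.1 p.2.1.1 p.2.1.2 U| ≤ 2 * (r.N : ℕ) := fun U =>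
    SoloBlind.abs_plaquetteCost_le ρ hρc _ _ _ U
  have hc : (0 : ℝ) ≤ β / 2 := by linarith
  have hcheb := measureReal_le_exp_mul_integral_exp (wilsonMeasure (d := 4) (L := L) ρ β) hφm hφK hc s
  have hset : {U : GaugeConfig 4 L G | s ≤ SoloBlind.plaquetteCost ρ p.1 p.2.1.1 p.2.1.2 U} =
      {U | s ≤ (r.N : ℝ) - (ρ (plaquetteHolonomy U x i j)).trace.re} := by
    ext U; simp only [Set.mem_setOf_eq, hp U]
  rw [hset] at hcheb
  refine hcheb.trans ?_
  -- the odd chessboard bound on the exponential moment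
  have hchess := SoloBlind.wilsonExpectation_exp_plaquetteCost_le (d := 4) (L := L) ρ hL hL3 hρc hβ0.le hc p
  rw [show β - β / 2 = β / 2 by ring] at hchess
  have hexpect : ∫ U, Real.exp (β / 2 * SoloBlind.plaquetteCost ρ p.1 p.2.1.1 p.2.1.2 U) ∂(wilsonMeasure (d := 4) (L := L) ρ β) =
      wilsonExpectation ρ β (fun U : GaugeConfig 4 L G => Real.exp (β / 2 * SoloBlind.plaquetteCost ρ p.1 p.2.1.1 p.2.1.2 U)) := rfl
  rw [hexpect]
  -- the exponent is volume-free
  have hL0 : (0 : ℝ) < (L : ℝ) ^ 4 := by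
    have : (0 : ℝ) < L := by exact_mod_cast (show 0 < L by omega)
    positivity
  have hup := OddTorusChessboard.torusLogPartition_nonpos_rep r (L := L) (β := β / 2) hc
  have hlow := hZ L β hβ
  have hE : (4 : ℝ) ^ 4 / (L : ℝ) ^ 4 * (torusLogPartition 4 ρ (β / 2) L - torusLogPartition 4 ρ β L) ≤
      12288 - 1024 * Real.log C₁ + 512 * (D : ℝ) * Real.log β := by
    have hdiff : torusLogPartition 4 ρ (β / 2) L - torusLogPartition 4 ρ β L ≤
        (L : ℝ) ^ 4 * (48 - 4 * Real.log C₁ + 2 * (D : ℝ) * Real.log β) := by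
      nlinarith
    have h44 : (4 : ℝ) ^ 4 = 256 := by norm_num
    calc (4 : ℝ) ^ 4 / (L : ℝ) ^ 4 * (torusLogPartition 4 ρ (β / 2) L - torusLogPartition 4 ρ β L)
        ≤ (4 : ℝ) ^ 4 / (L : ℝ) ^ 4 * ((L : ℝ) ^ 4 * (48 - 4 * Real.log C₁ + 2 * (D : ℝ) * Real.log β)) :=
          mul_le_mul_of_nonneg_left hdiff (by positivity)
      _ = 256 * (48 - 4 * Real.log C₁ + 2 * (D : ℝ) * Real.log β) := by
          rw [h44]; field_simp
      _ = 12288 - 1024 * Real.log C₁ + 512 * (D : ℝ) * Real.log β := by ring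
  have hmom : wilsonExpectation ρ β (fun U : GaugeConfig 4 L G =>
        Real.exp (β / 2 * SoloBlind.plaquetteCost ρ p.1 p.2.1.1 p.2.1.2 U)) ≤
      Real.exp (12288 - 1024 * Real.log C₁) * β ^ (512 * D) := by
    refine hchess.trans ((Real.exp_le_exp.2 hE).trans (le_of_eq ?_))
    rw [Real.exp_add, show 512 * (D : ℝ) * Real.log β = ((512 * D : ℕ) : ℝ) * Real.log β by push_cast; ring,
      ← Real.log_pow, Real.exp_log (pow_pos hβ0 _)]
  have e1 : Real.exp (-(β / 2 * s)) = Real.exp (-(β * s / 2)) := by ring_nf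
  rw [e1]
  calc Real.exp (-(β * s / 2)) *
        wilsonExpectation ρ β (fun U : GaugeConfig 4 L G => Real.exp (β / 2 * SoloBlind.plaquetteCost ρ p.1 p.2.1.1 p.2.1.2 U))
      ≤ Real.exp (-(β * s / 2)) * (Real.exp (12288 - 1024 * Real.log C₁) * β ^ (512 * D)) :=
        mul_le_mul_of_nonneg_left hmom (Real.exp_pos _).le
    _ = Real.exp (12288 - 1024 * Real.log C₁) * β ^ (512 * D) * Real.exp (-(β * s / 2)) := by ring

/-! ### All sides -/

/-- **The single-plaquette energy tail of the Wilson torus, any compact `G`, uniformly in the volume, ALL sides `L ≥ 2`**: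
`μ_{L,β}{U : s ≤ N − Re tr ρ U_p} ≤ C β^κ exp(−β s/2)` for `β ≥ 1`, `s ≥ 0`, every plaquette (even sides: chessboard,
`measureReal_plaqCost_ge_le_evenG`; odd sides: `measureReal_plaqCost_ge_le_oddG`). [cite: FrohlichIsraelLiebSimon1978, Thm. 4.1] -/
theorem measureReal_plaqCost_ge_le_allSidesG (r : LatticeRep G) :
    ∃ C : ℝ, 0 < C ∧ ∃ κ : ℕ, ∀ {L : ℕ} [NeZero L], 2 ≤ L → ∀ (β : ℝ), 1 ≤ β → ∀ (s : ℝ), 0 ≤ s →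
      ∀ (x : Site 4 L) {i j : Fin 4}, i ≠ j →
        (wilsonMeasure (d := 4) (L := L) r.ρ β).real
            {U : GaugeConfig 4 L G | s ≤ (r.N : ℝ) - (r.ρ (plaquetteHolonomy U x i j)).trace.re} ≤
          C * β ^ κ * Real.exp (-(β * s / 2)) := by
  obtain ⟨Ce, hCe, he⟩ := measureReal_plaqCost_ge_le_evenG r
  obtain ⟨Co, hCo, κ, ho⟩ := measureReal_plaqCost_ge_le_oddG r
  refine ⟨max Ce Co, lt_max_of_lt_left hCe, max (2 * dimE r.ρ) κ, ?_⟩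
  intro L _ hL2 β hβ s hs x i j hij
  haveI : Fact (1 < L) := ⟨by omega⟩
  have hpow : ∀ n : ℕ, n ≤ max (2 * dimE r.ρ) κ → β ^ n ≤ β ^ (max (2 * dimE r.ρ) κ) := fun n hn => pow_le_pow_right₀ hβ hn
  have hX := (Real.exp_pos (-(β * s / 2))).le
  rcases Nat.even_or_odd L with hev | hodd
  · refine (he hev β hβ s hs x hij).trans ?_
    have h1 : Ce * β ^ (2 * dimE r.ρ) ≤ max Ce Co * β ^ (max (2 * dimE r.ρ) κ) :=
      mul_le_mul (le_max_left _ _) (hpow _ (le_max_left _ _)) (by positivity) (le_trans hCe.le (le_max_left _ _))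
    exact mul_le_mul_of_nonneg_right h1 hX
  · have hL3 : 3 ≤ L := by obtain ⟨m, rfl⟩ := hodd; omega
    refine (ho hodd hL3 β hβ s hs x hij).trans ?_
    have h1 : Co * β ^ κ ≤ max Ce Co * β ^ (max (2 * dimE r.ρ) κ) :=
      mul_le_mul (le_max_right _ _) (hpow κ (le_max_right _ _)) (by positivity) (le_trans hCe.le (le_max_left _ _))
    exact mul_le_mul_of_nonneg_right h1 hX

end Summit.QuantumFields.YangMills.Theorems.ColdBoxAllGroups

end
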